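import Mathlib
import HarnessLib
import HarnessLib.Audit
import Summits.Langlands.Statement
import Summits.Langlands.Langlands.Theses.ParahoricFibre
import Summits.Langlands.Langlands.Theses.OrdinaryLocusCarving
import Literature.NumberTheory.GaloisRepresentations.OrdinaryRegular
import Literature.NumberTheory.GaloisRepresentations.LocalClassFieldTheory
import Literature.NumberTheory.GaloisRepresentations.LocalArtinMapPinned

/-!
# `OrdinaryLocusCarving` — lens-6 (barrier-complement carving), decomp-langlands g24, RESIDUAL MODE / BLOCKER FIRST (D-0179)

TARGET (used BY NAME, never restated): the rank-2 OPEN crux of the LIVE route `ParahoricFibre`,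
`Summit.Langlands.Langlands.Theses.ParahoricFibre.ParahoricOccurrence` (stmt-Langlands-18194; census v24 «EQUIV-to-target (untouched)»,
never cut by any lens): for `K` CM, `π` regular algebraic cuspidal on `GL_n(𝔸_K)`, `p > n²`, `p ∤ disc K`, `π` unramified
above `p`, `ρ : Γ_K → GL_n(ℚ̄_p)` semisimple and Satake–Frobenius compatible with `(π, ι)` a.e., an integral frame `g`
whose reduction contains `SL_n(𝔽_p)`, a decomposed generic prime `l ≠ p`, and a Taylor place `v ∤ p` (`q_v ≡ 1 (p)`,
`g ρ|_{Γ_{K_v}} g⁻¹ ≡ 1 mod 𝔪`, `ρ(I_v)` unipotent): for every `W = WD(ρ|_{Γ_{K_v}})` the local component `π_v` has a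
non-zero vector fixed by the parahoric `𝔭(W)` of the dual Jordan partition of `N = W.N` — PARAHORIC OCCURRENCE, i.e.
Matsumoto's condition (3) of Prop. 2.20 of arXiv:2312.01551, equivalent for Iwahori-spherical generic `π_v` to full
Frobenius-semisimple local–global compatibility at `v` [corpus: paper:arxiv-2312.01551 p.19 L1–14].

THE DIAL = ORDINARITY OF `ρ` ABOVE `p` — the hypothesis that separates the two printed patching technologies for `GL_n`
over CM fields (Hida theory / ordinary `R = 𝕋` with Ihara avoidance, which CHANGES THE WEIGHT: ACC+23 §6, Matsumoto
Thm. 4.56; versus Fontaine–Laffaille / crystalline patching at FIXED weight: ACC+23 §4, CN23, Matsumoto Thm. 4.52), and the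
exact complement of the hypothesis of the catalogued barrier `Literature.Barriers.Langlands.FamilyWitnessConsecutiveWeights`
(weight-0 family witnesses are what the NON-ordinary, fixed-weight method lacks).  Typed over accepted declarations only:
  `ORD(K,p,ρ)` := `(∀ w : HeightOneSpectrum (𝓞 K), ((p : ℕ) : 𝓞 K) ∈ w.asIdeal → ∀ art : LocalArtinData (w.adicCompletion K), art.IsCanonical → ρ.IsOrdinaryRegularAt w art)`
(`FramedGaloisRep.IsOrdinaryRegularAt` = Qian 2022 Def. 1.2 = Geraghty / Thorne «ordinary of some dominant labelled weight»,
characters matched on an OPEN subgroup of inertia, `Literature/NumberTheory/GaloisRepresentations/OrdinaryRegular.lean`;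
`LocalArtinData.IsCanonical` = normalised against THE pinned Artin map, `LocalClassFieldTheory.lean`; the same pair the tree's
named facts `Qian2022.potentialAutomorphy_ordinary 𝓐`, `Thorne2017.automorphyLifting_unitary_ordinaryMinimal 𝓐`,
`AllenNewtonThorne….automorphyLifting_residuallyReducible_ordinary` are stated over).  The dial is WELL POSED (kernel):
canonical Artin data exist at every completion (`canonicalArtinData_exists`, from the tree's PROVED local class field theory
`exists_isLocalArtinMap_holds`), any two give the same predicate (`isOrdinaryRegularAt_canonical_congr`), so the `∀ art`-form
equals the `∃ art`-form (`dial_forall_iff_exists`); it does not see the frame (`dial_conj_iff`, from the accepted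
`FramedGaloisRep.isOrdinaryRegularAt_conj_iff`); and by [corpus: paper:arxiv-2607.11763 p.5 Thm. 1.2.1] (A'Campo–Hevesi–
Thorne–Whitmore 2026: `r_{π,ι}|_{G_{F_v}}` is de Rham of the expected Hodge–Tate weights with `WD^{ss} ≅ rec^{ss}` at EVERY
`v ∣ p`, unconditionally) composed with [corpus: paper:arxiv-2312.01551 p.75 L1–7 (Lemma 5.18)] it is EQUIVALENT, for the
`ρ ≅ r_ι(π)` of the crux, to Matsumoto's automorphic `ι`-ordinarity of `π` (Def. 4.32, Hida's idempotent) — the junction `J1`.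

CELLS (each = the crux's text VERBATIM with ONE hypothesis inserted after the Fontaine–Laffaille clause
`(∀ w, p ∈ w → π unramified at w) →`; texts.json sha12: Ord f168b12e89f6, NonOrd 711ea347895d; host b7c38f52b16f):
* `OrdinaryParahoricOccurrence` — crux 2 · WEAKER (`ord_of_occurrence`) · PRINT MODULO TYPED JUNCTIONS, tagged ATTACKABLE:
  J1 (Galois-ordinary ⟺ `ι`-ordinary: AHTW26 Thm. 1.2.1 ∘ Matsumoto Lemma 5.18) → J2 = Matsumoto Thm. 6.13
  [corpus: paper:arxiv-2312.01551 p.90 L1–13] («`l > n²`, `π` `ι`-ordinary, `r̄` fully decomposed generic, `r̄|_{G_{F(ζ_l)}}`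
  absolutely irreducible, `ζ_l ∉ F` ⇒ `ιWD(r_ι(π)|_{G_{F_v}})^{F-ss} ≅ rec(π_v ⊗ |det|^{(1-n)/2})` for ALL `v ∤ l`, all `n`»; its
  proof = ordinary automorphy lifting with level raising at `v`, Thm. 4.56, + the Harris tensor-power trick, pp. 6–8) →
  J3 (host hypotheses ⇒ (1)–(3): `p ∤ disc K ⇒ ζ_p ∉ K`; image `⊇ SL_n(𝔽_p)`, `p > n² ⇒` (2); a FULLY decomposed generic prime
  (Def. 5.9, p.68–69: split completely AND `α_i/α_j ≠ l` for ALL `i, j`, so also `l ≢ 1 (p)`) by Chebotarev from the big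
  image — the host's own decomposed-generic clause asks `i ≠ j` and residue degree one only, so this is a genuine, routine,
  stub) → J4 = Matsumoto Prop. 2.20 (1)⇒(3) [p.19] + Flath.  Outside `FamilyWitnessConsecutiveWeights` BY CONSTRUCTION (Hida
  families through an ordinary point have classical points in every sufficiently regular weight: the barrier's hypothesis
  «no classical family witness in a neighbouring weight» is violated), outside `MonodromyNotClosedUnderPadicLimits` (no `N`
  is read off a limit: `N` comes from level-raising + Prop. 2.20, Matsumoto p.6 L20–30).
* `NonOrdinaryParahoricOccurrence` — residual 3 · WEAKER (`nonord_of_occurrence`) · DECLARED RESIDUAL · IDEA-NEEDED with a PRINT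
  sub-box: `n = 2`, weight 0 (Allen–Newton arXiv:1901.05490 Thm. 4.1: FL non-ordinary allowed in the patching range) and the
  positive-density-of-`l` statements of Matsumoto Thm. 1.3/1.5 (which do NOT decide a FIXED `p`); head-on
  `FamilyWitnessConsecutiveWeights` (fixed-weight crystalline patching has no weight-changing family; the level-raising
  congruence `π₀'` of Matsumoto's method must have the SAME weight and be FL at `p`) — the missing input is a non-ordinary
  («finite slope») replacement for Hida theory with control of the level at `v` (eigenvariety / trianguline patching over CM
  fields: BHS-type local models exist only in the polarizable setting).

KERNEL (EXACT mod NOTHING): `occurrence_iff_cells : ParahoricOccurrence ↔ Ord ∧ NonOrd` (pointwise excluded middle on the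
dial in `(K, p, ρ)`), `occurrence_of_cells : Ord → NonOrd → ParahoricOccurrence` BY NAME (the child route's `closes`), `ord_of_occurrence`,
`nonord_of_occurrence` (cells WEAKER), `closes : Ord → NonOrd → OccurrenceToGeneric → SmallRangeGenericMonodromy →
MonodromyToLanglands → ParahoricFibre.Assembly → Langlands` through the host's landed `ParahoricFibre.closes`.
SEAM (the parent's REGISTERED birth skeleton `Cruxes/ParahoricOccurrence/Lines/birth.lean`, re-homed per cell, pointwise):
`IwahoriOccurrence` (stub 1, KNOWN) → `ParahoricPatchingDatum∣cell` (stub 2 with the dial inserted at the same anchor; sha12 Ord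
756f664ab91f, NonOrd 32bdfce29b10, parent 7ebdde0158f3) → `LocalComponentOfParahoricFixed` (stub 3, KNOWN: Flath) ⇒ cell
(`ord_of_seam`, `nonord_of_seam`, `occurrence_of_seam`; `patchingDatum_iff_cells`).  For the ORD cell the INTENDED proof of
`OrdinaryParahoricPatchingDatum` is NOT the patching lever but J1–J4 (trivial datum `R = ℤ`, `M = ℤ` once global
`𝔭(W)`-occurrence is known from Matsumoto 6.13 + Prop. 2.20 + Flath) — see the memo's ORD line card.

Axioms of every theorem here: `propext`, `Classical.choice`, `Quot.sound`.  No `sorry`.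

CENSUS TWIN (census-1 g25): the route is BORN (77th cell route, route-Langlands-OrdinaryLocusCarving rev 0 @1bc908f6f0c2 = this node, crit-1 CLEARED
row 283 / of record 286; items ORD stmt-Langlands-27760 · NONORD 27761 · Assembly 27762 CLOSED by `Theorems/OrdinaryLocusCarvingAssembly.lean`), so the
two cells and the Assembly are NOT re-declared here: every kernel refers to the BORN ROUTE DECLS BY NAME (`open Summit.Langlands.Langlands.Theses.
OrdinaryLocusCarving (…)`); the dial certificates (§Dial) and the seam layer (§Seam: `IwahoriOccurrence`, `ParahoricPatchingDatum`, … — statements of the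
birth stubs, definitions of this file, NOT items) are the lens's text verbatim.  `--supports stmt-Langlands-18194 --as helper`.  Nothing here proves
`Langlands` or OCC.
-/

set_option linter.dupNamespace false -- project-wide option (lakefile weak.linter.dupNamespace); `Summit.Langlands.Langlands` is the mandated namespace

namespace Summit.Langlands.Langlands.Theorems.OrdinaryLocusCarving

open Summit.Langlands.Langlands.Theses.OrdinaryLocusCarving (OrdinaryParahoricOccurrence NonOrdinaryParahoricOccurrence)

open scoped BigOperators Topology Manifold Classical MeasureTheory ProbabilityTheory Matrix InnerProductSpace ComplexConjugate ContinuousMap NumberField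
open Filter Set Function TopologicalSpace MeasureTheory

/-! ## The two cells of the crux (route items; texts = crux verbatim + one insertion after the Fontaine–Laffaille clause) -/




/-! ## Kernel: EXACT mod NOTHING -/

/-- **ParahoricOccurrence ⟺ Ord ∧ NonOrd** — pointwise excluded middle on the dial `ORD(K,p,ρ)`. [folklore] -/
theorem occurrence_iff_cells :
    Summit.Langlands.Langlands.Theses.ParahoricFibre.ParahoricOccurrence ↔ (OrdinaryParahoricOccurrence ∧ NonOrdinaryParahoricOccurrence) := by
  constructor
  · intro h
    exact ⟨fun K _ _ hK n hcpt π hπ p _ ι ρ hss hsat hp hdisc hunr _ => h K hK n hcpt π hπ p ι ρ hss hsat hp hdisc hunr,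
      fun K _ _ hK n hcpt π hπ p _ ι ρ hss hsat hp hdisc hunr _ => h K hK n hcpt π hπ p ι ρ hss hsat hp hdisc hunr⟩
  · rintro ⟨hO, hN⟩ K _ _ hK n hcpt π hπ p _ ι ρ hss hsat hp hdisc hunr
    by_cases hd : (∀ w : IsDedekindDomain.HeightOneSpectrum (NumberField.RingOfIntegers K), ((p : ℕ) : NumberField.RingOfIntegers K) ∈ w.asIdeal → ∀ art : Literature.NumberTheory.GaloisRepresentations.LocalArtinData (w.adicCompletion K), art.IsCanonical → ρ.IsOrdinaryRegularAt w art)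
    · exact hO K hK n hcpt π hπ p ι ρ hss hsat hp hdisc hunr hd
    · exact hN K hK n hcpt π hπ p ι ρ hss hsat hp hdisc hunr hd

/-- **V-R glue**: the cells decide the PARENT decl by name. [folklore] -/
theorem occurrence_of_cells (hO : OrdinaryParahoricOccurrence) (hN : NonOrdinaryParahoricOccurrence) :
    Summit.Langlands.Langlands.Theses.ParahoricFibre.ParahoricOccurrence :=
  occurrence_iff_cells.2 ⟨hO, hN⟩


/-- cell ORD is WEAKER than the crux. [folklore] -/
theorem ord_of_occurrence (h : Summit.Langlands.Langlands.Theses.ParahoricFibre.ParahoricOccurrence) : OrdinaryParahoricOccurrence := (occurrence_iff_cells.1 h).1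
/-- cell NONORD is WEAKER than the crux. [folklore] -/
theorem nonord_of_occurrence (h : Summit.Langlands.Langlands.Theses.ParahoricFibre.ParahoricOccurrence) : NonOrdinaryParahoricOccurrence := (occurrence_iff_cells.1 h).2

/-- **ROOT**: the two cells and the host route's other items give `Langlands`, through the host's landed deciding theorem
`ParahoricFibre.closes`. [folklore] -/
theorem root_of_cells (hO : OrdinaryParahoricOccurrence) (hN : NonOrdinaryParahoricOccurrence)
    (hOG : Summit.Langlands.Langlands.Theses.ParahoricFibre.OccurrenceToGeneric) (hSmall : Summit.Langlands.Langlands.Theses.ParahoricFibre.SmallRangeGenericMonodromy)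
    (hJ : Summit.Langlands.Langlands.Theses.ParahoricFibre.MonodromyToLanglands) (hA : Summit.Langlands.Langlands.Theses.ParahoricFibre.Assembly) : _root_.Langlands :=
  Summit.Langlands.Langlands.Theses.ParahoricFibre.closes (occurrence_of_cells hO hN) hOG hSmall hJ hA

/-! ## The dial is well posed (kernel certificates) -/

section Dial

open IsDedekindDomain Literature.NumberTheory.GaloisRepresentations

variable (K : Type) [Field K] [NumberField K] (p : ℕ) [Fact p.Prime] {n : ℕ}

/-- The dial `ORD(K,p,ρ)`: at every place `w ∣ p`, `ρ|_{Γ_{K_w}}` is ordinary of some dominant labelled weight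
(`IsOrdinaryRegularAt`, Qian Def. 1.2) relative to every CANONICAL local Artin datum. [folklore] -/
def OrdinaryAtP (ρ : FramedGaloisRep K (PadicAlgCl p) n) : Prop :=
  ∀ w : HeightOneSpectrum (𝓞 K), ((p : ℕ) : 𝓞 K) ∈ w.asIdeal →
    ∀ art : LocalArtinData (w.adicCompletion K), art.IsCanonical → ρ.IsOrdinaryRegularAt w art

/-- The ORD cell's inserted hypothesis IS `OrdinaryAtP` (syntactic check). [folklore] -/
theorem ordinaryAtP_iff (ρ : FramedGaloisRep K (PadicAlgCl p) n) :
    OrdinaryAtP K p ρ ↔ (∀ w : IsDedekindDomain.HeightOneSpectrum (NumberField.RingOfIntegers K), ((p : ℕ) : NumberField.RingOfIntegers K) ∈ w.asIdeal → ∀ art : Literature.NumberTheory.GaloisRepresentations.LocalArtinData (w.adicCompletion K), art.IsCanonical → ρ.IsOrdinaryRegularAt w art) := Iff.rfl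

/-- **Canonical local Artin data exist at every completion** — the tree's PROVED local class field theory
(`exists_isLocalArtinMap_holds`, packaged by `LocalArtinData.ofExistsIsLocalArtinMap`). [folklore] -/
theorem canonicalArtinData_exists (w : HeightOneSpectrum (𝓞 K)) :
    ∃ art : LocalArtinData (w.adicCompletion K), art.IsCanonical :=
  ⟨LocalArtinData.ofExistsIsLocalArtinMap (exists_isLocalArtinMap_holds _),
    LocalArtinData.isCanonical_ofExistsIsLocalArtinMap _⟩

variable {K p} in
/-- **Two canonical data give the same ordinarity predicate** (the predicate reads only `art.artin`, and canonical data
share it: `LocalArtinData.IsCanonical.artin_eq`). [folklore] -/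
theorem isOrdinaryRegularAt_canonical_congr (w : HeightOneSpectrum (𝓞 K))
    {art art' : LocalArtinData (w.adicCompletion K)} (h : art.IsCanonical) (h' : art'.IsCanonical)
    (ρ : FramedGaloisRep K (PadicAlgCl p) n) :
    ρ.IsOrdinaryRegularAt w art ↔ ρ.IsOrdinaryRegularAt w art' := by
  simp only [FramedGaloisRep.IsOrdinaryRegularAt, FramedGaloisRep.IsOrdinaryRegular,
    FramedGaloisRep.IsOrdinaryOfLabelledWeight, h.artin_eq h']

/-- **`∀ canonical art` = `∃ canonical art`**: the dial does not depend on the quantifier over Artin data (so neither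
cell is vacuous or trivial on that account). [folklore] -/
theorem dial_forall_iff_exists (ρ : FramedGaloisRep K (PadicAlgCl p) n) :
    OrdinaryAtP K p ρ ↔ ∀ w : HeightOneSpectrum (𝓞 K), ((p : ℕ) : 𝓞 K) ∈ w.asIdeal →
      ∃ art : LocalArtinData (w.adicCompletion K), art.IsCanonical ∧ ρ.IsOrdinaryRegularAt w art := by
  refine forall_congr' fun w => forall_congr' fun _ => ?_
  constructor
  · intro h
    obtain ⟨art, hart⟩ := canonicalArtinData_exists K w
    exact ⟨art, hart, h art hart⟩
  · rintro ⟨art, hart, hord⟩ art' hart'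
    exact (isOrdinaryRegularAt_canonical_congr w hart' hart ρ).2 hord

/-- **The dial does not see the frame**: `ORD(K,p,PρP⁻¹) ↔ ORD(K,p,ρ)` (accepted
`FramedGaloisRep.isOrdinaryRegularAt_conj_iff`). [folklore] -/
theorem dial_conj_iff (P : GL (Fin n) (PadicAlgCl p)) (ρ : FramedGaloisRep K (PadicAlgCl p) n) :
    OrdinaryAtP K p (ρ.conj P) ↔ OrdinaryAtP K p ρ := by
  simp only [OrdinaryAtP, FramedGaloisRep.isOrdinaryRegularAt_conj_iff]

end Dial

/-! ## Seam: the parent's registered birth skeleton, re-homed per cell (statements verbatim from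
`Cruxes/ParahoricOccurrence/Lines/birth.lean`; stub 2 with the dial inserted at the same anchor) -/

section Seam

/-- stub 1 of the parent skeleton (KNOWN in print: Varma ss-compatibility + Borel + Flath), verbatim. -/
def IwahoriOccurrence : Prop :=
  open IsDedekindDomain NumberField Polynomial Filter Literature.NumberTheory.Automorphic Literature.NumberTheory.GaloisRepresentations Summit.Langlands in ∀ (K : Type) [Field K] [NumberField K], NumberField.IsCMField K → ∀ (n : ℕ) (hcpt : isCompact_glFiniteIntegralLevel n K) (π : CuspidalAutomorphicRepData n K hcpt), π.1.IsRegularAlgebraic → ∀ (p : ℕ) [Fact p.Prime] (ι : PadicAlgCl p ≃+* ℂ) (ρ : FramedGaloisRep K (PadicAlgCl p) n), ρ.toGaloisRep.IsSemisimple → (∀ᶠ v : HeightOneSpectrum (𝓞 K) in cofinite, ∀ α : Multiset ℂ, π.1.HasSatakeParamAt v α → ρ.IsUnramifiedAt v ∧ ρ.HasFrobCharpolyAt v (arithFrobPolyOfSatake ι v.residueCard n α)) → ∀ v : HeightOneSpectrum (𝓞 K), ((p : ℕ) : 𝓞 K) ∉ v.asIdeal → (∀ σ ∈ absInertia (v.adicCompletion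 K), (((ρ.toLocal v σ : GL (Fin n) (PadicAlgCl p)) : Matrix (Fin n) (Fin n) (PadicAlgCl p)) - 1) ^ n = 0) → ∃ φ ∈ π.1.W, φ ∉ π.1.W' ∧ ∀ g₁ : GL (Fin n) (v.adicCompletion K), (∀ i j : Fin n, Valued.v ((g₁ : Matrix (Fin n) (Fin n) (v.adicCompletion K)) i j) ≤ 1) → Valued.v (g₁ : Matrix (Fin n) (Fin n) (v.adicCompletion K)).det = 1 → (∀ i j : Fin n, j < i → Valued.v ((g₁ : Matrix (Fin n) (Fin n) (v.adicCompletion K)) i j) < 1) → rightTranslation (AdelicGroupData.gl n K) (GLn.ofLocal n K v g₁) φ - φ ∈ π.1.W'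

/-- stub 2 of the parent skeleton (the open lever), verbatim. -/
def ParahoricPatchingDatum : Prop :=
  open IsDedekindDomain NumberField Polynomial Filter Literature.NumberTheory.Automorphic Literature.NumberTheory.GaloisRepresentations Summit.Langlands in ∀ (K : Type) [Field K] [NumberField K], NumberField.IsCMField K → ∀ (n : ℕ) (hcpt : isCompact_glFiniteIntegralLevel n K) (π : CuspidalAutomorphicRepData n K hcpt), π.1.IsRegularAlgebraic → ∀ (p : ℕ) [Fact p.Prime] (ι : PadicAlgCl p ≃+* ℂ) (ρ : FramedGaloisRep K (PadicAlgCl p) n), ρ.toGaloisRep.IsSemisimple → (∀ᶠ v : HeightOneSpectrum (𝓞 K) in cofinite, ∀ α : Multiset ℂ, π.1.HasSatakeParamAt v α → ρ.IsUnramifiedAt v ∧ ρ.HasFrobCharpolyAt v (arithFrobPolyOfSatake ι v.residueCard n α)) → n ^ 2 < p → ¬ ((p : ℤ) ∣ NumberField.discr K) → (∀ w : HeightOneSpectrum (𝓞 K), ((p : ℕ) : 𝓞 K) ∈ w.asIdeal → π.1.IsUnramifiedAt w) → ∀ g : GL (Fin n) (PadicAlgCl p), (∀ (σ : Field.absoluteGaloisGroup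 K) (i j : Fin n), ‖((g * ρ σ * g⁻¹ : GL (Fin n) (PadicAlgCl p)) : Matrix (Fin n) (Fin n) (PadicAlgCl p)) i j‖ ≤ 1) → (∀ M : Matrix (Fin n) (Fin n) ℤ, M.det = 1 → ∃ σ : Field.absoluteGaloisGroup K, ∀ i j : Fin n, ‖((g * ρ σ * g⁻¹ : GL (Fin n) (PadicAlgCl p)) : Matrix (Fin n) (Fin n) (PadicAlgCl p)) i j - ((M i j : ℤ) : PadicAlgCl p)‖ < 1) → (∃ l : ℕ, l.Prime ∧ l ≠ p ∧ ∀ w : HeightOneSpectrum (𝓞 K), ((l : ℕ) : 𝓞 K) ∈ w.asIdeal → w.residueCard = l ∧ ρ.IsUnramifiedAt w ∧ ∃ a : Fin n → PadicAlgCl p, ρ.HasFrobCharpolyAt w (∏ i, (X - C (a i))) ∧ ∀ i j : Fin n, i ≠ j → ‖a i - a j‖ = 1 ∧ ‖a i - (l : PadicAlgCl p) * a j‖ = 1) → ∀ v : HeightOneSpectrum (𝓞 K), ((p : ℕ) : 𝓞 K) ∉ v.asIdeal → p ∣ (v.residueCard - 1) → (∀ (σ : Field.absoluteGaloisGroup (v.adicCompletion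 K)) (i j : Fin n), ‖((g * ρ.toLocal v σ * g⁻¹ : GL (Fin n) (PadicAlgCl p)) : Matrix (Fin n) (Fin n) (PadicAlgCl p)) i j - (1 : Matrix (Fin n) (Fin n) (PadicAlgCl p)) i j‖ < 1) → (∀ σ ∈ absInertia (v.adicCompletion K), (((ρ.toLocal v σ : GL (Fin n) (PadicAlgCl p)) : Matrix (Fin n) (Fin n) (PadicAlgCl p)) - 1) ^ n = 0) → ∀ W : WeilDeligneRep (v.adicCompletion K) (PadicAlgCl p) (Fin n → PadicAlgCl p), IsWeilDeligneOfLadic (ρ.toLocal v).toWeilGroupHom W → (∃ φ ∈ π.1.W, φ ∉ π.1.W' ∧ ∀ g₁ : GL (Fin n) (v.adicCompletion K), (∀ i j : Fin n, Valued.v ((g₁ : Matrix (Fin n) (Fin n) (v.adicCompletion K)) i j) ≤ 1) → Valued.v (g₁ : Matrix (Fin n) (Fin n) (v.adicCompletion K)).det = 1 → (∀ i j : Fin n, j < i → Valued.v ((g₁ : Matrix (Fin n) (Fin n) (v.adicCompletion K)) i j) < 1) → rightTranslation (AdelicGroupData.gl n K) (GLn.ofLocal n K v g₁) φ - φ ∈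 π.1.W') → ∃ (R : Type) (_ : CommRing R) (_ : IsNoetherianRing R) (M : Type) (_ : AddCommGroup M) (_ : Module R M) (_ : Module.Finite R M) (𝔮 𝔭x : Ideal R) (_ : 𝔮.IsPrime) (_ : 𝔭x.IsPrime), 𝔮 ≤ 𝔭x ∧ Nontrivial (LocalizedModule 𝔮.primeCompl M) ∧ (Nontrivial (LocalizedModule 𝔭x.primeCompl M) → ∃ φ ∈ π.1.W, φ ∉ π.1.W' ∧ ∀ g₁ : GL (Fin n) (v.adicCompletion K), (∀ i j : Fin n, Valued.v ((g₁ : Matrix (Fin n) (Fin n) (v.adicCompletion K)) i j) ≤ 1) → Valued.v (g₁ : Matrix (Fin n) (Fin n) (v.adicCompletion K)).det = 1 → (∀ i j : Fin n, (Finset.univ.filter fun t : Fin n => n ≤ j.val + Module.finrank (PadicAlgCl p) (LinearMap.range (W.N ^ (t.val + 1)))).card < (Finset.univ.filter fun t : Fin n => n ≤ i.val + Module.finrank (PadicAlgCl p) (LinearMap.range (W.N ^ (t.val + 1)))).card → Valued.v ((g₁ : Matrix (Fin n) (Fin n) (v.adicCompletion K)) i j) < 1) → rightTranslation (AdelicGroupData.gl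 n K) (GLn.ofLocal n K v g₁) φ - φ ∈ π.1.W')

/-- stub 2 ∣ ORD: the dial inserted after the Fontaine–Laffaille clause.  Intended proof: J1–J4 (Matsumoto 6.13), NOT patching. -/
def OrdinaryParahoricPatchingDatum : Prop :=
  open IsDedekindDomain NumberField Polynomial Filter Literature.NumberTheory.Automorphic Literature.NumberTheory.GaloisRepresentations Summit.Langlands in ∀ (K : Type) [Field K] [NumberField K], NumberField.IsCMField K → ∀ (n : ℕ) (hcpt : isCompact_glFiniteIntegralLevel n K) (π : CuspidalAutomorphicRepData n K hcpt), π.1.IsRegularAlgebraic → ∀ (p : ℕ) [Fact p.Prime] (ι : PadicAlgCl p ≃+* ℂ) (ρ : FramedGaloisRep K (PadicAlgCl p) n), ρ.toGaloisRep.IsSemisimple → (∀ᶠ v : HeightOneSpectrum (𝓞 K) in cofinite, ∀ α : Multiset ℂ, π.1.HasSatakeParamAt v α → ρ.IsUnramifiedAt v ∧ ρ.HasFrobCharpolyAt v (arithFrobPolyOfSatake ι v.residueCard n α)) → n ^ 2 < p → ¬ ((p : ℤ) ∣ NumberField.discr K) → (∀ w : HeightOneSpectrum (𝓞 K), ((p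 : ℕ) : 𝓞 K) ∈ w.asIdeal → π.1.IsUnramifiedAt w) → (∀ w : HeightOneSpectrum (𝓞 K), ((p : ℕ) : 𝓞 K) ∈ w.asIdeal → ∀ art : LocalArtinData (w.adicCompletion K), art.IsCanonical → ρ.IsOrdinaryRegularAt w art) → ∀ g : GL (Fin n) (PadicAlgCl p), (∀ (σ : Field.absoluteGaloisGroup K) (i j : Fin n), ‖((g * ρ σ * g⁻¹ : GL (Fin n) (PadicAlgCl p)) : Matrix (Fin n) (Fin n) (PadicAlgCl p)) i j‖ ≤ 1) → (∀ M : Matrix (Fin n) (Fin n) ℤ, M.det = 1 → ∃ σ : Field.absoluteGaloisGroup K, ∀ i j : Fin n, ‖((g * ρ σ * g⁻¹ : GL (Fin n) (PadicAlgCl p)) : Matrix (Fin n) (Fin n) (PadicAlgCl p)) i j - ((M i j : ℤ) : PadicAlgCl p)‖ < 1) → (∃ l : ℕ, l.Prime ∧ l ≠ p ∧ ∀ w : HeightOneSpectrum (𝓞 K), ((l : ℕ) : 𝓞 K) ∈ w.asIdeal → w.residueCard = l ∧ ρ.IsUnramifiedAt w ∧ ∃ a : Fin n → PadicAlgCl p,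 ρ.HasFrobCharpolyAt w (∏ i, (X - C (a i))) ∧ ∀ i j : Fin n, i ≠ j → ‖a i - a j‖ = 1 ∧ ‖a i - (l : PadicAlgCl p) * a j‖ = 1) → ∀ v : HeightOneSpectrum (𝓞 K), ((p : ℕ) : 𝓞 K) ∉ v.asIdeal → p ∣ (v.residueCard - 1) → (∀ (σ : Field.absoluteGaloisGroup (v.adicCompletion K)) (i j : Fin n), ‖((g * ρ.toLocal v σ * g⁻¹ : GL (Fin n) (PadicAlgCl p)) : Matrix (Fin n) (Fin n) (PadicAlgCl p)) i j - (1 : Matrix (Fin n) (Fin n) (PadicAlgCl p)) i j‖ < 1) → (∀ σ ∈ absInertia (v.adicCompletion K), (((ρ.toLocal v σ : GL (Fin n) (PadicAlgCl p)) : Matrix (Fin n) (Fin n) (PadicAlgCl p)) - 1) ^ n = 0) → ∀ W : WeilDeligneRep (v.adicCompletion K) (PadicAlgCl p) (Fin n → PadicAlgCl p), IsWeilDeligneOfLadic (ρ.toLocal v).toWeilGroupHom W → (∃ φ ∈ π.1.W, φ ∉ π.1.W' ∧ ∀ g₁ : GL (Fin n) (v.adicCompletion K), (∀ i j : Fin n,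 Valued.v ((g₁ : Matrix (Fin n) (Fin n) (v.adicCompletion K)) i j) ≤ 1) → Valued.v (g₁ : Matrix (Fin n) (Fin n) (v.adicCompletion K)).det = 1 → (∀ i j : Fin n, j < i → Valued.v ((g₁ : Matrix (Fin n) (Fin n) (v.adicCompletion K)) i j) < 1) → rightTranslation (AdelicGroupData.gl n K) (GLn.ofLocal n K v g₁) φ - φ ∈ π.1.W') → ∃ (R : Type) (_ : CommRing R) (_ : IsNoetherianRing R) (M : Type) (_ : AddCommGroup M) (_ : Module R M) (_ : Module.Finite R M) (𝔮 𝔭x : Ideal R) (_ : 𝔮.IsPrime) (_ : 𝔭x.IsPrime), 𝔮 ≤ 𝔭x ∧ Nontrivial (LocalizedModule 𝔮.primeCompl M) ∧ (Nontrivial (LocalizedModule 𝔭x.primeCompl M) → ∃ φ ∈ π.1.W, φ ∉ π.1.W' ∧ ∀ g₁ : GL (Fin n) (v.adicCompletion K), (∀ i j : Fin n, Valued.v ((g₁ : Matrix (Fin n) (Fin n) (v.adicCompletion K)) i j) ≤ 1) → Valued.v (g₁ : Matrix (Fin n) (Fin n) (v.adicCompletion K)).det = 1 → (∀ i j : Fin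 n, (Finset.univ.filter fun t : Fin n => n ≤ j.val + Module.finrank (PadicAlgCl p) (LinearMap.range (W.N ^ (t.val + 1)))).card < (Finset.univ.filter fun t : Fin n => n ≤ i.val + Module.finrank (PadicAlgCl p) (LinearMap.range (W.N ^ (t.val + 1)))).card → Valued.v ((g₁ : Matrix (Fin n) (Fin n) (v.adicCompletion K)) i j) < 1) → rightTranslation (AdelicGroupData.gl n K) (GLn.ofLocal n K v g₁) φ - φ ∈ π.1.W')

/-- stub 2 ∣ NONORD: the negated dial inserted after the Fontaine–Laffaille clause (the residual's open core). -/
def NonOrdinaryParahoricPatchingDatum : Prop :=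
  open IsDedekindDomain NumberField Polynomial Filter Literature.NumberTheory.Automorphic Literature.NumberTheory.GaloisRepresentations Summit.Langlands in ∀ (K : Type) [Field K] [NumberField K], NumberField.IsCMField K → ∀ (n : ℕ) (hcpt : isCompact_glFiniteIntegralLevel n K) (π : CuspidalAutomorphicRepData n K hcpt), π.1.IsRegularAlgebraic → ∀ (p : ℕ) [Fact p.Prime] (ι : PadicAlgCl p ≃+* ℂ) (ρ : FramedGaloisRep K (PadicAlgCl p) n), ρ.toGaloisRep.IsSemisimple → (∀ᶠ v : HeightOneSpectrum (𝓞 K) in cofinite, ∀ α : Multiset ℂ, π.1.HasSatakeParamAt v α → ρ.IsUnramifiedAt v ∧ ρ.HasFrobCharpolyAt v (arithFrobPolyOfSatake ι v.residueCard n α)) → n ^ 2 < p → ¬ ((p : ℤ) ∣ NumberField.discr K) → (∀ w : HeightOneSpectrum (𝓞 K), ((p : ℕ) : 𝓞 K) ∈ w.asIdeal → π.1.IsUnramifiedAt w) → ¬ (∀ w : HeightOneSpectrum (𝓞 K), ((p : ℕ) : 𝓞 K) ∈ w.asIdeal → ∀ art : LocalArtinData (w.adicCompletion K), art.IsCanonical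 → ρ.IsOrdinaryRegularAt w art) → ∀ g : GL (Fin n) (PadicAlgCl p), (∀ (σ : Field.absoluteGaloisGroup K) (i j : Fin n), ‖((g * ρ σ * g⁻¹ : GL (Fin n) (PadicAlgCl p)) : Matrix (Fin n) (Fin n) (PadicAlgCl p)) i j‖ ≤ 1) → (∀ M : Matrix (Fin n) (Fin n) ℤ, M.det = 1 → ∃ σ : Field.absoluteGaloisGroup K, ∀ i j : Fin n, ‖((g * ρ σ * g⁻¹ : GL (Fin n) (PadicAlgCl p)) : Matrix (Fin n) (Fin n) (PadicAlgCl p)) i j - ((M i j : ℤ) : PadicAlgCl p)‖ < 1) → (∃ l : ℕ, l.Prime ∧ l ≠ p ∧ ∀ w : HeightOneSpectrum (𝓞 K), ((l : ℕ) : 𝓞 K) ∈ w.asIdeal → w.residueCard = l ∧ ρ.IsUnramifiedAt w ∧ ∃ a : Fin n → PadicAlgCl p, ρ.HasFrobCharpolyAt w (∏ i, (X - C (a i))) ∧ ∀ i j : Fin n, i ≠ j → ‖a i - a j‖ = 1 ∧ ‖a i - (l : PadicAlgCl p) * a j‖ = 1) → ∀ v : HeightOneSpectrum (𝓞 K), ((p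 : ℕ) : 𝓞 K) ∉ v.asIdeal → p ∣ (v.residueCard - 1) → (∀ (σ : Field.absoluteGaloisGroup (v.adicCompletion K)) (i j : Fin n), ‖((g * ρ.toLocal v σ * g⁻¹ : GL (Fin n) (PadicAlgCl p)) : Matrix (Fin n) (Fin n) (PadicAlgCl p)) i j - (1 : Matrix (Fin n) (Fin n) (PadicAlgCl p)) i j‖ < 1) → (∀ σ ∈ absInertia (v.adicCompletion K), (((ρ.toLocal v σ : GL (Fin n) (PadicAlgCl p)) : Matrix (Fin n) (Fin n) (PadicAlgCl p)) - 1) ^ n = 0) → ∀ W : WeilDeligneRep (v.adicCompletion K) (PadicAlgCl p) (Fin n → PadicAlgCl p), IsWeilDeligneOfLadic (ρ.toLocal v).toWeilGroupHom W → (∃ φ ∈ π.1.W, φ ∉ π.1.W' ∧ ∀ g₁ : GL (Fin n) (v.adicCompletion K), (∀ i j : Fin n, Valued.v ((g₁ : Matrix (Fin n) (Fin n) (v.adicCompletion K)) i j) ≤ 1) → Valued.v (g₁ : Matrix (Fin n) (Fin n) (v.adicCompletion K)).det = 1 → (∀ i j : Fin n, j < i → Valued.v ((g₁ : Matrix (Fin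 n) (Fin n) (v.adicCompletion K)) i j) < 1) → rightTranslation (AdelicGroupData.gl n K) (GLn.ofLocal n K v g₁) φ - φ ∈ π.1.W') → ∃ (R : Type) (_ : CommRing R) (_ : IsNoetherianRing R) (M : Type) (_ : AddCommGroup M) (_ : Module R M) (_ : Module.Finite R M) (𝔮 𝔭x : Ideal R) (_ : 𝔮.IsPrime) (_ : 𝔭x.IsPrime), 𝔮 ≤ 𝔭x ∧ Nontrivial (LocalizedModule 𝔮.primeCompl M) ∧ (Nontrivial (LocalizedModule 𝔭x.primeCompl M) → ∃ φ ∈ π.1.W, φ ∉ π.1.W' ∧ ∀ g₁ : GL (Fin n) (v.adicCompletion K), (∀ i j : Fin n, Valued.v ((g₁ : Matrix (Fin n) (Fin n) (v.adicCompletion K)) i j) ≤ 1) → Valued.v (g₁ : Matrix (Fin n) (Fin n) (v.adicCompletion K)).det = 1 → (∀ i j : Fin n, (Finset.univ.filter fun t : Fin n => n ≤ j.val + Module.finrank (PadicAlgCl p) (LinearMap.range (W.N ^ (t.val + 1)))).card < (Finset.univ.filter fun t : Fin n => n ≤ i.val + Module.finrank (PadicAlgCl p) (LinearMap.range (W.N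 ^ (t.val + 1)))).card → Valued.v ((g₁ : Matrix (Fin n) (Fin n) (v.adicCompletion K)) i j) < 1) → rightTranslation (AdelicGroupData.gl n K) (GLn.ofLocal n K v g₁) φ - φ ∈ π.1.W')

/-- stub 3 of the parent skeleton (KNOWN in print: Flath localisation at parahoric level), verbatim. -/
def LocalComponentOfParahoricFixed : Prop :=
  open IsDedekindDomain NumberField Polynomial Filter Literature.NumberTheory.Automorphic Literature.NumberTheory.GaloisRepresentations Summit.Langlands in ∀ (K : Type) [Field K] [NumberField K] (n : ℕ) (hcpt : isCompact_glFiniteIntegralLevel n K) (π : CuspidalAutomorphicRepData n K hcpt) (v : HeightOneSpectrum (𝓞 K)) (b : Fin n → ℕ), (∃ φ ∈ π.1.W, φ ∉ π.1.W' ∧ ∀ g₁ : GL (Fin n) (v.adicCompletion K), (∀ i j : Fin n, Valued.v ((g₁ : Matrix (Fin n) (Fin n) (v.adicCompletion K)) i j) ≤ 1) → Valued.v (g₁ : Matrix (Fin n) (Fin n) (v.adicCompletion K)).det = 1 → (∀ i j : Fin n, b j < b i → Valued.v ((g₁ : Matrix (Fin n) (Fin n) (v.adicCompletion K)) i j) <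 1) → rightTranslation (AdelicGroupData.gl n K) (GLn.ofLocal n K v g₁) φ - φ ∈ π.1.W') → ∃ πv : SmoothIrrep (GL (Fin n) (v.adicCompletion K)), π.1.HasLocalComponentAt v πv.ρ ∧ ∃ x : πv.V, x ≠ 0 ∧ ∀ g₁ : GL (Fin n) (v.adicCompletion K), (∀ i j : Fin n, Valued.v ((g₁ : Matrix (Fin n) (Fin n) (v.adicCompletion K)) i j) ≤ 1) → Valued.v (g₁ : Matrix (Fin n) (Fin n) (v.adicCompletion K)).det = 1 → (∀ i j : Fin n, b j < b i → Valued.v ((g₁ : Matrix (Fin n) (Fin n) (v.adicCompletion K)) i j) < 1) → πv.ρ g₁ x = x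

/-- **stub 2 ⟺ stub 2∣ORD ∧ stub 2∣NONORD** (pointwise excluded middle, same dial). [folklore] -/
theorem patchingDatum_iff_cells :
    ParahoricPatchingDatum ↔ (OrdinaryParahoricPatchingDatum ∧ NonOrdinaryParahoricPatchingDatum) := by
  constructor
  · intro h
    exact ⟨fun K _ _ hK n hcpt π hπ p _ ι ρ hss hsat hp hdisc hunr _ => h K hK n hcpt π hπ p ι ρ hss hsat hp hdisc hunr,
      fun K _ _ hK n hcpt π hπ p _ ι ρ hss hsat hp hdisc hunr _ => h K hK n hcpt π hπ p ι ρ hss hsat hp hdisc hunr⟩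
  · rintro ⟨hO, hN⟩ K _ _ hK n hcpt π hπ p _ ι ρ hss hsat hp hdisc hunr
    by_cases hd : (∀ w : IsDedekindDomain.HeightOneSpectrum (NumberField.RingOfIntegers K), ((p : ℕ) : NumberField.RingOfIntegers K) ∈ w.asIdeal → ∀ art : Literature.NumberTheory.GaloisRepresentations.LocalArtinData (w.adicCompletion K), art.IsCanonical → ρ.IsOrdinaryRegularAt w art)
    · exact hO K hK n hcpt π hπ p ι ρ hss hsat hp hdisc hunr hd
    · exact hN K hK n hcpt π hπ p ι ρ hss hsat hp hdisc hunr hd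

/-- Support is closed under specialisation (`Module.mem_support_mono` on `LocalizedModule`s) — the parent skeleton's proved
helper, re-proved here so that nothing with a `sorry` is imported. [folklore] -/
theorem nontrivial_localizedModule_of_le {R : Type*} [CommRing R] {M : Type*} [AddCommGroup M]
    [Module R M] {𝔮 𝔭 : Ideal R} [𝔮.IsPrime] [𝔭.IsPrime] (hle : 𝔮 ≤ 𝔭)
    (h : Nontrivial (LocalizedModule 𝔮.primeCompl M)) :
    Nontrivial (LocalizedModule 𝔭.primeCompl M) := by
  have h𝔮 : (⟨𝔮, inferInstance⟩ : PrimeSpectrum R) ∈ Module.support R M := h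
  have h𝔭 : (⟨𝔭, inferInstance⟩ : PrimeSpectrum R) ∈ Module.support R M :=
    Module.mem_support_mono (show (⟨𝔮, inferInstance⟩ : PrimeSpectrum R) ≤ ⟨𝔭, inferInstance⟩ from hle) h𝔮
  exact h𝔭

/-- **The parent's composition, verbatim** (stub 1 → stub 2 → stub 3 ⇒ crux), re-proved pointwise. [folklore] -/
theorem occurrence_of_seam (h₁ : IwahoriOccurrence) (h₂ : ParahoricPatchingDatum) (h₃ : LocalComponentOfParahoricFixed) :
    Summit.Langlands.Langlands.Theses.ParahoricFibre.ParahoricOccurrence := by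
  intro K _ _ hK n hcpt π hreg p _ ι ρ hss hsat hp hdisc hunr g hint hbig hl v hv hq htriv hunip W hW
  have hIw := h₁ K hK n hcpt π hreg p ι ρ hss hsat v hv hunip
  obtain ⟨R, _, _, M, _, _, _, 𝔮, 𝔭x, _, _, hle, hgen, hfib⟩ :=
    h₂ K hK n hcpt π hreg p ι ρ hss hsat hp hdisc hunr g hint hbig hl v hv hq htriv hunip W hW hIw
  have hx : Nontrivial (LocalizedModule 𝔭x.primeCompl M) := nontrivial_localizedModule_of_le hle hgen
  exact h₃ K n hcpt π v _ (hfib hx)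

/-- **ORD cell from the seam**: stub 1 → stub 2∣ORD → stub 3 ⇒ `OrdinaryParahoricOccurrence`. [folklore] -/
theorem ord_of_seam (h₁ : IwahoriOccurrence) (h₂ : OrdinaryParahoricPatchingDatum) (h₃ : LocalComponentOfParahoricFixed) :
    OrdinaryParahoricOccurrence := by
  intro K _ _ hK n hcpt π hreg p _ ι ρ hss hsat hp hdisc hunr hd g hint hbig hl v hv hq htriv hunip W hW
  have hIw := h₁ K hK n hcpt π hreg p ι ρ hss hsat v hv hunip
  obtain ⟨R, _, _, M, _, _, _, 𝔮, 𝔭x, _, _, hle, hgen, hfib⟩ :=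
    h₂ K hK n hcpt π hreg p ι ρ hss hsat hp hdisc hunr hd g hint hbig hl v hv hq htriv hunip W hW hIw
  have hx : Nontrivial (LocalizedModule 𝔭x.primeCompl M) := nontrivial_localizedModule_of_le hle hgen
  exact h₃ K n hcpt π v _ (hfib hx)

/-- **NONORD cell from the seam**: stub 1 → stub 2∣NONORD → stub 3 ⇒ `NonOrdinaryParahoricOccurrence`. [folklore] -/
theorem nonord_of_seam (h₁ : IwahoriOccurrence) (h₂ : NonOrdinaryParahoricPatchingDatum) (h₃ : LocalComponentOfParahoricFixed) :
    NonOrdinaryParahoricOccurrence := by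
  intro K _ _ hK n hcpt π hreg p _ ι ρ hss hsat hp hdisc hunr hd g hint hbig hl v hv hq htriv hunip W hW
  have hIw := h₁ K hK n hcpt π hreg p ι ρ hss hsat v hv hunip
  obtain ⟨R, _, _, M, _, _, _, 𝔮, 𝔭x, _, _, hle, hgen, hfib⟩ :=
    h₂ K hK n hcpt π hreg p ι ρ hss hsat hp hdisc hunr hd g hint hbig hl v hv hq htriv hunip W hW hIw
  have hx : Nontrivial (LocalizedModule 𝔭x.primeCompl M) := nontrivial_localizedModule_of_le hle hgen
  exact h₃ K n hcpt π v _ (hfib hx)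

/-- the parent's open stub is WEAKER-OR-EQUAL split: stub 2 ⇒ stub 2∣ORD. [folklore] -/
theorem ordinaryPatchingDatum_of (h : ParahoricPatchingDatum) : OrdinaryParahoricPatchingDatum := (patchingDatum_iff_cells.1 h).1
/-- stub 2 ⇒ stub 2∣NONORD. [folklore] -/
theorem nonOrdinaryPatchingDatum_of (h : ParahoricPatchingDatum) : NonOrdinaryParahoricPatchingDatum := (patchingDatum_iff_cells.1 h).2

end Seam

end Summit.Langlands.Langlands.Theorems.OrdinaryLocusCarving
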